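import Summits.CriticalPhenomena.PercolationContinuityZ3.Theorems.PercNearOneGluingNoHeavyQuantZeroOneK4
import Summits.CriticalPhenomena.PercolationContinuityZ3.Theorems.PercNearOneGluingNoHeavyQuantThreePortTransfer
import HarnessLib

/-!
# The `½`-marginal row on at most four vertices: ONE relay with `μ(o↔v) ≥ ½` forces `μ{N ≤ 1} ≤ 1 − q_min` on `K4`
# (MAJORITY(3) / Zmax / POCKET-½ hold for `n ≤ 4`; they are FALSE at `n = 5`)

builds on p205010 (kernel theorem, internal audit signed; external expert review pending)

Support file (`--supports stmt-CriticalPhenomena-4575`), seat `prim-quant-p1` (gen 4); memo `run/shared/lean/prim/quant/P1-SURPLUS.md` §14.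
No definitions, no named facts, no sorries; standard axioms.  SETTING as in `…QuantZeroOneK4`: observer `o`, relays `a, b, c`,
`o, a, b, c` exhaust the vertex set (`K4`: hairs `α, β, γ` at `o`, triangle `x = w(ab)`, `y = w(ac)`, `z = w(bc)`), `q_v = μ(o↔v)`.

* `ThreePort.k4_residual_lt_half` (pure real algebra) — if all three pocket exchanges fail on `K4` (closed forms `z·c_z < T⁻`,
  `y·c_y < W_b`, `x·c_x < W_c` of `k4_residual_false`) then the `K4` marginal polynomial
  `q_a = α + ᾱ[β·xȳz̄ + γ·yx̄z̄ + (β+γ−βγ)(xy+xz+yz−2xyz)]` is `< ½`.  KEY IDENTITY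
  `½ − q_a = (W_c − x c_x) + (W_b − y c_y) + (D₀ − z·Q₁)`, `Q₁ = ᾱ(β̄γ·xȳ + βγ̄·x̄y) ≥ 0`, and the bilinear interpolation
  `c_z·D₀ − T⁻·Q₁ = x̄ȳ·P₀₀ + xȳ·P₁₀ + x̄y·P₀₁ + xy·P₁₁` with manifestly nonnegative corner values
  `P₀₀ = c_z·u/2`, `P₁₀ = T⁻·ᾱβγ̄ + c_z·u/2`, `P₀₁ = T⁻·ᾱβ̄γ + c_z·u/2`, `8P₁₁ = c_z(12T⁻ + 4βγ + 2α(1−2β) + 2α(1−2γ) + 4u)`,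
  `u = (1−2α)(1−2β)(1−2γ) > 0`; as `c_z ≥ ᾱβγ̄ > 0` this gives `D₀ − zQ₁ ≥ 0`, so `½ − q_a > 0`.
* `ThreePort.le_one_reached_le_K4_of_half` — **on `K4`: `μ(o↔a) ≥ ½` (ONE relay) and `t ≥ μ(o↮v)` (`v = a,b,c`) ⟹ `μ{N ≤ 1} ≤ t`.**
  If some apex exchange holds: `measureReal_le_one_le_compl_of_exchange`; else `margin_eq` + triangle cells give the caps and
  `real_openConn` + `real_pairOnly_K4` + `real_allApart_K4` + `cells_sum_eq_one` identify `μ(o↔a)` with the marginal polynomial.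
* `…_of_exists_half` (any of the three relays), `majorityThree_of_card_le_four` (`OneCutFive.ZeroOneThree`'s shape, every `n ≤ 4`),
  `…_of_sum_gt` (`Σ_v μ(o↔v) ≥ 3/2` suffices; in particular `Z(3,2)` on `≤ 4` vertices, `le_one_reached_le_K4` of p217375, is contained).

SHARPNESS / CONTEXT.  (i) FIVE vertices: star `.481/.466/.479` at `o` plus a weak hub has all three marginals `> ½` and
`μ{N ≤ 1} > 1 − q_min` — `OneCutFivePocketHalfRefutation.not_pocketHalf` / `not_zmax` (kernel evaluation, seat prim-ineq-gen-8).  So the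
census conjecture MAJORITY ('all `q_v ≥ ½`, `|A| ≥ 2j+1` ⟹ `μ(N ≤ j) ≤ 1 − q_min`', CENSUS-GAIN v9 §14.4) is at `j = 1` exactly POCKET-½:
TRUE on `≤ 4` vertices (this file) and on trees, FALSE from `n = 5` on.  (ii) `½` is sharp for three independent relays: hairs `(h,t,t)`,
`h < ½`, give `μ{N ≤ 1} − (1−t) = t(1−t)(1−2h) > 0`.  (iii) On `≤ 4` vertices every violator of FAR's layer-1 conclusion has all marginals
`< ½`, hence `Σ_v μ(o↔v) < 3/2`; the `n = 5` witness has `Σ = 1.501`.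
[cite: KozmaNitzan2024, Lemma 2 (p. 6)] (context: level 1 of the family); the statements here are this programme's.
-/

noncomputable section

namespace Summit.CriticalPhenomena.PercolationContinuityZ3.Theorems

open MeasureTheory Set Literature.Probability.LatticeModels Literature.Probability.Percolation
open scoped Classical BigOperators

variable {n : ℕ}

namespace ThreePort

/-! ### The residual real inequality: all three exchanges fail ⟹ `q_a < ½` -/

/-- **All three pocket exchanges fail on `K4` ⟹ the marginal polynomial of `a` is `< ½`** (pure real algebra; hypotheses `ga, gb, gc`
verbatim as in `k4_residual_false`).  Identity `½ − q_a = (W_c − x c_x) + (W_b − y c_y) + (D₀ − zQ₁)`, `D₀ − zQ₁ ≥ 0` by the corner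
decomposition of `c_z D₀ − T⁻ Q₁` described in the file header. [this work] -/
theorem k4_residual_lt_half (α β γ x y z : ℝ) (hα0 : 0 ≤ α) (hα1 : α ≤ 1) (hβ0 : 0 ≤ β) (hβ1 : β ≤ 1)
    (hγ0 : 0 ≤ γ) (hγ1 : γ ≤ 1) (hx0 : 0 ≤ x) (hx1 : x ≤ 1) (hy0 : 0 ≤ y) (hy1 : y ≤ 1) (hz0 : 0 ≤ z)
    (ga : (1 - z) * ((1 - α) * β * γ - α * (1 - β) * (1 - γ)) + z * (β + γ - β * γ - α) < 0)
    (gb : (1 - y) * ((1 - β) * α * γ - β * (1 - α) * (1 - γ)) + y * (α + γ - α * γ - β) < 0)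
    (gc : (1 - x) * ((1 - γ) * α * β - γ * (1 - α) * (1 - β)) + x * (α + β - α * β - γ) < 0) :
    α + (1 - α) * (β * (x * (1 - y) * (1 - z)) + γ * (y * (1 - x) * (1 - z)) +
      (β + γ - β * γ) * (x * y + x * z + y * z - 2 * (x * y * z))) < 1 / 2 := by
  -- names for the recurring polynomials (as in `k4_residual_false`)
  set Tm := α * (1 - β) * (1 - γ) - (1 - α) * β * γ with hTm
  set Wb := (1 - α) * β * (1 - γ) - α * (1 - β) * γ with hWb
  set Wc := (1 - α) * γ * (1 - β) - α * (1 - γ) * β with hWc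
  set cz := (1 - α) * (β + γ - 2 * β * γ) with hcz
  set cy := (1 - β) * (α + γ - 2 * α * γ) with hcy
  set cx := (1 - γ) * (α + β - 2 * α * β) with hcx
  -- the three failed exchanges in 'cap' form
  have ea : (1 - z) * ((1 - α) * β * γ - α * (1 - β) * (1 - γ)) + z * (β + γ - β * γ - α) = z * cz - Tm := by
    rw [hcz, hTm]; ring
  have eb : (1 - y) * ((1 - β) * α * γ - β * (1 - α) * (1 - γ)) + y * (α + γ - α * γ - β) = y * cy - Wb := by
    rw [hcy, hWb]; ring
  have ec : (1 - x) * ((1 - γ) * α * β - γ * (1 - α) * (1 - β)) + x * (α + β - α * β - γ) = x * cx - Wc := by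
    rw [hcx, hWc]; ring
  have ga' : z * cz < Tm := (by linarith [ea]); have gb' : y * cy < Wb := (by linarith [eb])
  have gc' : x * cx < Wc := by linarith [ec]
  -- nonnegativity of the c's
  have hK1 : 0 ≤ α * (1 - γ) + (1 - α) * γ := by
    have := mul_nonneg hα0 (sub_nonneg.2 hγ1); have := mul_nonneg (sub_nonneg.2 hα1) hγ0; linarith
  have hK2 : 0 ≤ α * (1 - β) + (1 - α) * β := by
    have := mul_nonneg hα0 (sub_nonneg.2 hβ1); have := mul_nonneg (sub_nonneg.2 hα1) hβ0; linarith
  have hK3 : 0 ≤ β * (1 - γ) + (1 - β) * γ := by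
    have := mul_nonneg hβ0 (sub_nonneg.2 hγ1); have := mul_nonneg (sub_nonneg.2 hβ1) hγ0; linarith
  have hcz0 : 0 ≤ cz := by
    rw [hcz]; have : β + γ - 2 * β * γ = β * (1 - γ) + (1 - β) * γ := by ring
    rw [this]; exact mul_nonneg (sub_nonneg.2 hα1) hK3
  have hcy0 : 0 ≤ cy := by
    rw [hcy]; have : α + γ - 2 * α * γ = α * (1 - γ) + (1 - α) * γ := by ring
    rw [this]; exact mul_nonneg (sub_nonneg.2 hβ1) hK1
  have hcx0 : 0 ≤ cx := by
    rw [hcx]; have : α + β - 2 * α * β = α * (1 - β) + (1 - α) * β := by ring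
    rw [this]; exact mul_nonneg (sub_nonneg.2 hγ1) hK2
  -- positivity of Tm, Wb, Wc
  have hT : 0 < Tm := lt_of_le_of_lt (mul_nonneg hz0 hcz0) ga'
  have hWb0 : 0 < Wb := lt_of_le_of_lt (mul_nonneg hy0 hcy0) gb'
  have hWc0 : 0 < Wc := lt_of_le_of_lt (mul_nonneg hx0 hcx0) gc'
  -- all hairs below 1/2
  have e1 : Tm + Wc = (1 - 2 * β) * (α * (1 - γ) + (1 - α) * γ) := by rw [hTm, hWc]; ring
  have e2 : Tm + Wb = (1 - 2 * γ) * (α * (1 - β) + (1 - α) * β) := by rw [hTm, hWb]; ring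
  have e3 : Wb + Wc = (1 - 2 * α) * (β * (1 - γ) + (1 - β) * γ) := by rw [hWb, hWc]; ring
  have hβh : 0 < 1 - 2 * β := by
    by_contra h
    have h' : 1 - 2 * β ≤ 0 := by linarith
    have : (1 - 2 * β) * (α * (1 - γ) + (1 - α) * γ) ≤ 0 := mul_nonpos_of_nonpos_of_nonneg h' hK1
    linarith
  have hγh : 0 < 1 - 2 * γ := by
    by_contra h
    have h' : 1 - 2 * γ ≤ 0 := by linarith
    have : (1 - 2 * γ) * (α * (1 - β) + (1 - α) * β) ≤ 0 := mul_nonpos_of_nonpos_of_nonneg h' hK2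
    linarith
  have hαh : 0 < 1 - 2 * α := by
    by_contra h
    have h' : 1 - 2 * α ≤ 0 := by linarith
    have : (1 - 2 * α) * (β * (1 - γ) + (1 - β) * γ) ≤ 0 := mul_nonpos_of_nonpos_of_nonneg h' hK3
    linarith
  -- the z-slope `Q₁ ≥ 0` and the `z = 0` remainder `D₀`
  set Q1 := (1 - α) * ((1 - β) * γ * (x * (1 - y)) + β * (1 - γ) * ((1 - x) * y)) with hQ1
  set D0 := 1 / 2 - (α + (1 - α) * (β * (x * (1 - y)) + γ * (y * (1 - x)) + (β + γ - β * γ) * (x * y)))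
    - Wc + x * cx - Wb + y * cy with hD0
  have key : 1 / 2 - (α + (1 - α) * (β * (x * (1 - y) * (1 - z)) + γ * (y * (1 - x) * (1 - z)) +
      (β + γ - β * γ) * (x * y + x * z + y * z - 2 * (x * y * z)))) =
      (Wc - x * cx) + (Wb - y * cy) + (D0 - z * Q1) := by
    rw [hD0, hQ1, hWc, hWb, hcx, hcy]; ring
  have hQ1nn : 0 ≤ Q1 := by
    rw [hQ1]
    have h1 : 0 ≤ (1 - β) * γ * (x * (1 - y)) :=
      mul_nonneg (mul_nonneg (sub_nonneg.2 hβ1) hγ0) (mul_nonneg hx0 (sub_nonneg.2 hy1))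
    have h2 : 0 ≤ β * (1 - γ) * ((1 - x) * y) :=
      mul_nonneg (mul_nonneg hβ0 (sub_nonneg.2 hγ1)) (mul_nonneg (sub_nonneg.2 hx1) hy0)
    exact mul_nonneg (sub_nonneg.2 hα1) (add_nonneg h1 h2)
  -- the bilinear interpolation of `cz·D₀ − Tm·Q₁` through its four (nonnegative) corner values
  have hu : 0 ≤ (1 - 2 * α) * (1 - 2 * β) * (1 - 2 * γ) := mul_nonneg (mul_nonneg hαh.le hβh.le) hγh.le
  have hP : 0 ≤ cz * D0 - Tm * Q1 := by
    have hinterp : cz * D0 - Tm * Q1 =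
        (1 - x) * (1 - y) * (cz * ((1 - 2 * α) * (1 - 2 * β) * (1 - 2 * γ)) / 2)
        + x * (1 - y) * (Tm * ((1 - α) * β * (1 - γ)) + cz * ((1 - 2 * α) * (1 - 2 * β) * (1 - 2 * γ)) / 2)
        + (1 - x) * y * (Tm * ((1 - α) * (1 - β) * γ) + cz * ((1 - 2 * α) * (1 - 2 * β) * (1 - 2 * γ)) / 2)
        + x * y * (cz * (12 * Tm + 4 * (β * γ) + 2 * (α * (1 - 2 * β)) + 2 * (α * (1 - 2 * γ))
            + 4 * ((1 - 2 * α) * (1 - 2 * β) * (1 - 2 * γ))) / 8) := by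
      rw [hD0, hQ1, hTm, hWb, hWc, hcx, hcy, hcz]; ring
    rw [hinterp]
    have c00 : 0 ≤ cz * ((1 - 2 * α) * (1 - 2 * β) * (1 - 2 * γ)) / 2 := by
      have := mul_nonneg hcz0 hu; linarith
    have c10 : 0 ≤ Tm * ((1 - α) * β * (1 - γ)) + cz * ((1 - 2 * α) * (1 - 2 * β) * (1 - 2 * γ)) / 2 := by
      have := mul_nonneg hT.le (mul_nonneg (mul_nonneg (sub_nonneg.2 hα1) hβ0) (sub_nonneg.2 hγ1)); linarith
    have c01 : 0 ≤ Tm * ((1 - α) * (1 - β) * γ) + cz * ((1 - 2 * α) * (1 - 2 * β) * (1 - 2 * γ)) / 2 := by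
      have := mul_nonneg hT.le (mul_nonneg (mul_nonneg (sub_nonneg.2 hα1) (sub_nonneg.2 hβ1)) hγ0); linarith
    have c11 : 0 ≤ cz * (12 * Tm + 4 * (β * γ) + 2 * (α * (1 - 2 * β)) + 2 * (α * (1 - 2 * γ))
        + 4 * ((1 - 2 * α) * (1 - 2 * β) * (1 - 2 * γ))) / 8 := by
      have h1 : 0 ≤ β * γ := mul_nonneg hβ0 hγ0
      have h2 : 0 ≤ α * (1 - 2 * β) := mul_nonneg hα0 hβh.le
      have h3 : 0 ≤ α * (1 - 2 * γ) := mul_nonneg hα0 hγh.le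
      have : 0 ≤ cz * (12 * Tm + 4 * (β * γ) + 2 * (α * (1 - 2 * β)) + 2 * (α * (1 - 2 * γ))
          + 4 * ((1 - 2 * α) * (1 - 2 * β) * (1 - 2 * γ))) := mul_nonneg hcz0 (by linarith)
      linarith
    have t00 := mul_nonneg (mul_nonneg (sub_nonneg.2 hx1) (sub_nonneg.2 hy1)) c00
    have t10 := mul_nonneg (mul_nonneg hx0 (sub_nonneg.2 hy1)) c10
    have t01 := mul_nonneg (mul_nonneg (sub_nonneg.2 hx1) hy0) c01
    have t11 := mul_nonneg (mul_nonneg hx0 hy0) c11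
    linarith
  -- `cz·(D₀ − zQ₁) = (cz D₀ − Tm Q₁) + Q₁ (Tm − z cz) ≥ 0` and `cz > 0`, hence `D₀ − zQ₁ ≥ 0`
  have hczD : 0 ≤ cz * (D0 - z * Q1) := by
    have e : cz * (D0 - z * Q1) = (cz * D0 - Tm * Q1) + Q1 * (Tm - z * cz) := by ring
    rw [e]; exact add_nonneg hP (mul_nonneg hQ1nn (by linarith))
  have hcz_pos : 0 < cz := by
    have e : cz = (1 - α) * β * (1 - γ) + (1 - α) * (1 - β) * γ := by rw [hcz]; ring
    have h1 : 0 ≤ (1 - α) * (1 - β) * γ := mul_nonneg (mul_nonneg (sub_nonneg.2 hα1) (sub_nonneg.2 hβ1)) hγ0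
    have h2 : 0 ≤ α * (1 - β) * γ := mul_nonneg (mul_nonneg hα0 (sub_nonneg.2 hβ1)) hγ0
    have h3 : α * (1 - β) * γ < (1 - α) * β * (1 - γ) := by rw [hWb] at hWb0; linarith
    rw [e]; linarith
  have hD : 0 ≤ D0 - z * Q1 := by
    by_contra h
    have h' : D0 - z * Q1 < 0 := lt_of_not_ge h
    have := mul_neg_of_pos_of_neg hcz_pos h'
    linarith
  linarith [key, hD, gb', gc']

/-! ### The theorem on `K4` -/

/-- **On every weighted graph whose vertices are `o, a, b, c`: if `μ(o↔a) ≥ ½` and `t ≥ μ(o↮v)` for `v = a, b, c`, then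
`μ{o reaches at most one of a, b, c} ≤ t`** (`R = {a,b,c}`).  Equivalently `μ(N ≥ 2) ≥ min_v μ(o↔v)` as soon as ONE marginal is `≥ ½`
— the `n ≤ 4` case of the rows Zmax / POCKET-½ / MAJORITY(3), all FALSE at `n = 5` (`OneCutFivePocketHalfRefutation.not_zmax`).
Proof: an exchange at any apex suffices (`OneCutFive.measureReal_le_one_le_compl_of_exchange`); if all three fail, `ThreePort.margin_eq`
and the triangle cells put the weights in the residual region, where `ThreePort.real_openConn` and `k4_residual_lt_half` give
`μ(o↔a) < ½`. [this work] -/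
theorem le_one_reached_le_K4_of_half (w : Sym2 (Fin n) → unitInterval) (R : Finset (Fin n)) (o a b c : Fin n) (t : ℝ)
    (hR : R = {a, b, c}) (hao : a ≠ o) (hbo : b ≠ o) (hco : c ≠ o) (hab : a ≠ b) (hac : a ≠ c) (hbc : b ≠ c)
    (huniv : ∀ u : Fin n, u = o ∨ u = a ∨ u = b ∨ u = c)
    (hhalf : 1 / 2 ≤ (prodBernoulli w).real (openConn o a))
    (hta : (prodBernoulli w).real (openConn o a)ᶜ ≤ t) (htb : (prodBernoulli w).real (openConn o b)ᶜ ≤ t)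
    (htc : (prodBernoulli w).real (openConn o c)ᶜ ≤ t) :
    (prodBernoulli w).real {ω : BondConfig (Fin n) | (R.filter fun v => ω ∈ openConn o v).card ≤ 1} ≤ t := by
  have ha : a ∈ R := (by simp [hR]); have hb : b ∈ R := (by simp [hR]); have hc : c ∈ R := by simp [hR]
  -- exchange at some apex suffices
  by_cases hA : (prodBernoulli w).real {ω | ω ∈ openConn o a ∧ ω ∉ openConn o b ∧ ω ∉ openConn o c} ≤
      (prodBernoulli w).real {ω | ω ∉ openConn o a ∧ ω ∈ openConn o b ∧ ω ∈ openConn o c}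
  · exact (OneCutFive.measureReal_le_one_le_compl_of_exchange w R o a b c ha hb hc hab hac hbc hA).trans hta
  by_cases hB : (prodBernoulli w).real {ω | ω ∈ openConn o b ∧ ω ∉ openConn o a ∧ ω ∉ openConn o c} ≤
      (prodBernoulli w).real {ω | ω ∉ openConn o b ∧ ω ∈ openConn o a ∧ ω ∈ openConn o c}
  · exact (OneCutFive.measureReal_le_one_le_compl_of_exchange w R o b a c hb ha hc hab.symm hbc hac hB).trans htb
  by_cases hC : (prodBernoulli w).real {ω | ω ∈ openConn o c ∧ ω ∉ openConn o a ∧ ω ∉ openConn o b} ≤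
      (prodBernoulli w).real {ω | ω ∉ openConn o c ∧ ω ∈ openConn o a ∧ ω ∈ openConn o b}
  · exact (OneCutFive.measureReal_le_one_le_compl_of_exchange w R o c a b hc ha hb hac.symm hbc.symm hab hC).trans htc
  exfalso
  push Not at hA hB hC
  -- three-port hypotheses (vacuous: there is no fifth vertex)
  have hobs : ∀ u, u ≠ o → u ≠ a → u ≠ b → u ≠ c → w s(o, u) = 0 := by
    intro u h1 h2 h3 h4; rcases huniv u with h | h | h | h <;> contradiction
  have hobs' : ∀ u, u ≠ o → u ≠ b → u ≠ a → u ≠ c → w s(o, u) = 0 := fun u h1 h2 h3 h4 => hobs u h1 h3 h2 h4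
  have hobs'' : ∀ u, u ≠ o → u ≠ c → u ≠ a → u ≠ b → w s(o, u) = 0 := fun u h1 h2 h3 h4 => hobs u h1 h3 h4 h2
  have hunivB : ∀ u : Fin n, u = o ∨ u = b ∨ u = a ∨ u = c := fun u => by rcases huniv u with h | h | h | h <;> simp [h]
  have hunivC : ∀ u : Fin n, u = o ∨ u = c ∨ u = a ∨ u = b := fun u => by rcases huniv u with h | h | h | h <;> simp [h]
  -- margins at the three apexes
  have hma := margin_eq w o a b c hao hbo hco hab hac hbc hobs
  have hmb := margin_eq w o b a c hbo hao hco hab.symm hbc hac hobs'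
  have hmc := margin_eq w o c a b hco hao hbo hac.symm hbc.symm hab hobs''
  -- the marginal of `a` in cells, and the cell bookkeeping identity
  have hqa := real_openConn w o a b c hao hbo hco hab hac hbc hobs
  have hcells := cells_sum_eq_one w o a b c
  -- the two apex-pair cells of `a`, rewritten into the `real_pairOnly_K4` shape (reachability is symmetric)
  have hUab : {ω : BondConfig (Fin n) | (openGraph (ω ∩ {e | o ∉ e})).Reachable a b ∧
      ¬ (openGraph (ω ∩ {e | o ∉ e})).Reachable a c} =
      {ω | (openGraph (ω ∩ {e | o ∉ e})).Reachable a b ∧ ¬ (openGraph (ω ∩ {e | o ∉ e})).Reachable c a} := by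
    ext ω; simp only [Set.mem_setOf_eq]
    exact ⟨fun h => ⟨h.1, fun h' => h.2 h'.symm⟩, fun h => ⟨h.1, fun h' => h.2 h'.symm⟩⟩
  have hUac : {ω : BondConfig (Fin n) | (openGraph (ω ∩ {e | o ∉ e})).Reachable a c ∧
      ¬ (openGraph (ω ∩ {e | o ∉ e})).Reachable a b} =
      {ω | (openGraph (ω ∩ {e | o ∉ e})).Reachable a c ∧ ¬ (openGraph (ω ∩ {e | o ∉ e})).Reachable b a} := by
    ext ω; simp only [Set.mem_setOf_eq]
    exact ⟨fun h => ⟨h.1, fun h' => h.2 h'.symm⟩, fun h => ⟨h.1, fun h' => h.2 h'.symm⟩⟩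
  rw [hUab, hUac] at hqa hcells
  -- triangle cells
  rw [real_allApart_K4 w o a b c hao hbo hco hab hac hbc huniv, real_pairOnly_K4 w o a b c hao hbo hco hab hac hbc huniv] at hma
  rw [real_allApart_K4 w o b a c hbo hao hco hab.symm hbc hac hunivB,
    real_pairOnly_K4 w o b a c hbo hao hco hab.symm hbc hac hunivB] at hmb
  rw [real_allApart_K4 w o c a b hco hao hbo hac.symm hbc.symm hab hunivC,
    real_pairOnly_K4 w o c a b hco hao hbo hac.symm hbc.symm hab hunivC] at hmc
  rw [real_pairOnly_K4 w o c a b hco hao hbo hac.symm hbc.symm hab hunivC,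
    real_pairOnly_K4 w o b a c hbo hao hco hab.symm hbc hac hunivB] at hqa hcells
  rw [real_pairOnly_K4 w o a b c hao hbo hco hab hac hbc huniv, real_allApart_K4 w o a b c hao hbo hco hab hac hbc huniv] at hcells
  have sba : s(b, a) = s(a, b) := Sym2.eq_swap; have sca : s(c, a) = s(a, c) := Sym2.eq_swap
  have scb : s(c, b) = s(b, c) := Sym2.eq_swap
  rw [sba] at hmb; rw [sca, scb] at hmc; rw [sca, scb, sba] at hqa hcells
  -- abbreviations
  set μ := prodBernoulli w with hμ
  set U3 : ℝ := μ.real {ω : BondConfig (Fin n) | (openGraph (ω ∩ {e | o ∉ e})).Reachable a b ∧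
      (openGraph (ω ∩ {e | o ∉ e})).Reachable a c} with hU3
  set α : ℝ := (w s(o, a) : ℝ) with hα
  set β : ℝ := (w s(o, b) : ℝ) with hβ
  set γ : ℝ := (w s(o, c) : ℝ) with hγ
  set x : ℝ := (w s(a, b) : ℝ) with hx
  set y : ℝ := (w s(a, c) : ℝ) with hy
  set z : ℝ := (w s(b, c) : ℝ) with hz
  have hα0 : 0 ≤ α := unitInterval.nonneg _; have hα1 : α ≤ 1 := unitInterval.le_one _
  have hβ0 : 0 ≤ β := unitInterval.nonneg _; have hβ1 : β ≤ 1 := unitInterval.le_one _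
  have hγ0 : 0 ≤ γ := unitInterval.nonneg _; have hγ1 : γ ≤ 1 := unitInterval.le_one _
  have hx0 : 0 ≤ x := unitInterval.nonneg _; have hx1 : x ≤ 1 := unitInterval.le_one _
  have hy0 : 0 ≤ y := unitInterval.nonneg _; have hy1 : y ≤ 1 := unitInterval.le_one _
  have hz0 : 0 ≤ z := unitInterval.nonneg _; have hz1 : z ≤ 1 := unitInterval.le_one _
  -- the three failed exchanges in closed form (divide out the nonnegative prefactors)
  have ga : (1 - z) * ((1 - α) * β * γ - α * (1 - β) * (1 - γ)) + z * (β + γ - β * γ - α) < 0 := by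
    have e : μ.real {ω | ω ∉ openConn o a ∧ ω ∈ openConn o b ∧ ω ∈ openConn o c} -
        μ.real {ω | ω ∈ openConn o a ∧ ω ∉ openConn o b ∧ ω ∉ openConn o c} =
        (1 - x) * (1 - y) * ((1 - z) * ((1 - α) * β * γ - α * (1 - β) * (1 - γ)) + z * (β + γ - β * γ - α)) := by
      rw [hma]; ring
    by_contra h
    push Not at h
    have : 0 ≤ (1 - x) * (1 - y) * ((1 - z) * ((1 - α) * β * γ - α * (1 - β) * (1 - γ)) + z * (β + γ - β * γ - α)) :=
      mul_nonneg (mul_nonneg (by linarith) (by linarith)) h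
    linarith
  have gb : (1 - y) * ((1 - β) * α * γ - β * (1 - α) * (1 - γ)) + y * (α + γ - α * γ - β) < 0 := by
    have e : μ.real {ω | ω ∉ openConn o b ∧ ω ∈ openConn o a ∧ ω ∈ openConn o c} -
        μ.real {ω | ω ∈ openConn o b ∧ ω ∉ openConn o a ∧ ω ∉ openConn o c} =
        (1 - x) * (1 - z) * ((1 - y) * ((1 - β) * α * γ - β * (1 - α) * (1 - γ)) + y * (α + γ - α * γ - β)) := by
      rw [hmb]; ring
    by_contra h
    push Not at h
    have : 0 ≤ (1 - x) * (1 - z) * ((1 - y) * ((1 - β) * α * γ - β * (1 - α) * (1 - γ)) + y * (α + γ - α * γ - β)) :=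
      mul_nonneg (mul_nonneg (by linarith) (by linarith)) h
    linarith
  have gc : (1 - x) * ((1 - γ) * α * β - γ * (1 - α) * (1 - β)) + x * (α + β - α * β - γ) < 0 := by
    have e : μ.real {ω | ω ∉ openConn o c ∧ ω ∈ openConn o a ∧ ω ∈ openConn o b} -
        μ.real {ω | ω ∈ openConn o c ∧ ω ∉ openConn o a ∧ ω ∉ openConn o b} =
        (1 - y) * (1 - z) * ((1 - x) * ((1 - γ) * α * β - γ * (1 - α) * (1 - β)) + x * (α + β - α * β - γ)) := by
      rw [hmc]; ring
    by_contra h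
    push Not at h
    have : 0 ≤ (1 - y) * (1 - z) * ((1 - x) * ((1 - γ) * α * β - γ * (1 - α) * (1 - β)) + x * (α + β - α * β - γ)) :=
      mul_nonneg (mul_nonneg (by linarith) (by linarith)) h
    linarith
  -- the marginal of `a` is the K4 marginal polynomial
  have hU3eq : U3 = x * y + x * z + y * z - 2 * (x * y * z) := by
    have h1 : U3 = 1 - x * (1 - y) * (1 - z) - y * (1 - x) * (1 - z) - z * (1 - x) * (1 - y)
        - (1 - x) * (1 - y) * (1 - z) := by linarith [hcells]
    rw [h1]; ring
  have hqa' : μ.real (openConn o a) = α + (1 - α) * (β * (x * (1 - y) * (1 - z)) + γ * (y * (1 - x) * (1 - z)) +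
      (β + γ - β * γ) * (x * y + x * z + y * z - 2 * (x * y * z))) := by
    rw [hqa, ← hU3eq]
  have hlt := k4_residual_lt_half α β γ x y z hα0 hα1 hβ0 hβ1 hγ0 hγ1 hx0 hx1 hy0 hy1 hz0 ga gb gc
  rw [← hqa'] at hlt
  linarith

/-- **Some relay of `K4` with marginal `≥ ½`** (any of `a, b, c`): same conclusion, by relabelling. [this work] -/
theorem le_one_reached_le_K4_of_exists_half (w : Sym2 (Fin n) → unitInterval) (R : Finset (Fin n)) (o a b c : Fin n) (t : ℝ)
    (hR : R = {a, b, c}) (hao : a ≠ o) (hbo : b ≠ o) (hco : c ≠ o) (hab : a ≠ b) (hac : a ≠ c) (hbc : b ≠ c)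
    (huniv : ∀ u : Fin n, u = o ∨ u = a ∨ u = b ∨ u = c)
    (hhalf : 1 / 2 ≤ (prodBernoulli w).real (openConn o a) ∨ 1 / 2 ≤ (prodBernoulli w).real (openConn o b) ∨
      1 / 2 ≤ (prodBernoulli w).real (openConn o c))
    (hta : (prodBernoulli w).real (openConn o a)ᶜ ≤ t) (htb : (prodBernoulli w).real (openConn o b)ᶜ ≤ t)
    (htc : (prodBernoulli w).real (openConn o c)ᶜ ≤ t) :
    (prodBernoulli w).real {ω : BondConfig (Fin n) | (R.filter fun v => ω ∈ openConn o v).card ≤ 1} ≤ t := by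
  rcases hhalf with h | h | h
  · exact le_one_reached_le_K4_of_half w R o a b c t hR hao hbo hco hab hac hbc huniv h hta htb htc
  · have hR' : R = {b, a, c} := by
      rw [hR]; ext u; simp only [Finset.mem_insert, Finset.mem_singleton]; tauto
    have huniv' : ∀ u : Fin n, u = o ∨ u = b ∨ u = a ∨ u = c := fun u => by
      rcases huniv u with h | h | h | h <;> simp [h]
    exact le_one_reached_le_K4_of_half w R o b a c t hR' hbo hao hco hab.symm hbc hac huniv' h htb hta htc
  · have hR' : R = {c, a, b} := by
      rw [hR]; ext u; simp only [Finset.mem_insert, Finset.mem_singleton]; tauto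
    have huniv' : ∀ u : Fin n, u = o ∨ u = c ∨ u = a ∨ u = b := fun u => by
      rcases huniv u with h | h | h | h <;> simp [h]
    exact le_one_reached_le_K4_of_half w R o c a b t hR' hco hao hbo hac.symm hbc.symm hab huniv' h htc hta htb

/-- **`Z(3,2)` on `K4` is a special case**: `Σ_v μ(o↔v) > 2` forces some marginal `> 2/3 ≥ ½`, so `le_one_reached_le_K4` (p217375)
follows from `le_one_reached_le_K4_of_exists_half`. [this work] -/
theorem le_one_reached_le_K4_of_sum_gt (w : Sym2 (Fin n) → unitInterval) (R : Finset (Fin n)) (o a b c : Fin n) (t : ℝ)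
    (hR : R = {a, b, c}) (hao : a ≠ o) (hbo : b ≠ o) (hco : c ≠ o) (hab : a ≠ b) (hac : a ≠ c) (hbc : b ≠ c)
    (huniv : ∀ u : Fin n, u = o ∨ u = a ∨ u = b ∨ u = c)
    (hsum : 3 / 2 ≤ (prodBernoulli w).real (openConn o a) + (prodBernoulli w).real (openConn o b) +
      (prodBernoulli w).real (openConn o c))
    (hta : (prodBernoulli w).real (openConn o a)ᶜ ≤ t) (htb : (prodBernoulli w).real (openConn o b)ᶜ ≤ t)
    (htc : (prodBernoulli w).real (openConn o c)ᶜ ≤ t) :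
    (prodBernoulli w).real {ω : BondConfig (Fin n) | (R.filter fun v => ω ∈ openConn o v).card ≤ 1} ≤ t := by
  refine le_one_reached_le_K4_of_exists_half w R o a b c t hR hao hbo hco hab hac hbc huniv ?_ hta htb htc
  by_contra h
  push Not at h
  obtain ⟨h1, h2, h3⟩ := h
  linarith

/-! ### The `n ≤ 4` shape -/

/-- **MAJORITY(3) / Zmax for every weighted graph on at most four vertices** (in `OneCutFive.ZeroOneThree`'s shape, `n ≤ 4`):
for `R` with `|R| = 3`, SOME `v ∈ R` with `μ(o↔v) ≥ ½`, and `μ(o↮v) ≤ t` on `R`: `μ{o reaches at most one vertex of R} ≤ t`.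
If `o ∈ R` this is trivial; if `o ∉ R` then `R ∪ {o}` is the whole vertex set and `le_one_reached_le_K4_of_exists_half` applies.
FALSE on five vertices (`OneCutFivePocketHalfRefutation.not_zmax`). [this work] -/
theorem majorityThree_of_card_le_four (hn : n ≤ 4) (w : Sym2 (Fin n) → unitInterval) (R : Finset (Fin n)) (o : Fin n) (t : ℝ)
    (hR3 : R.card = 3) (hhalf : ∃ v ∈ R, 1 / 2 ≤ (prodBernoulli w).real (openConn o v))
    (hcut : ∀ v ∈ R, (prodBernoulli w).real (openConn o v)ᶜ ≤ t) :
    (prodBernoulli w).real {ω : BondConfig (Fin n) | (R.filter fun v => ω ∈ openConn o v).card ≤ 1} ≤ t := by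
  by_cases hoR : o ∈ R
  · -- trivial case: some `v ∈ R`, `v ≠ o`, and `{card ≤ 1} ⊆ {o ↮ v}`
    obtain ⟨v, hvR, hvo⟩ : ∃ v ∈ R, v ≠ o := by
      obtain ⟨v, hv, hne⟩ := Finset.exists_mem_ne (show 1 < R.card by omega) o; exact ⟨v, hv, hne⟩
    have hsub : {ω : BondConfig (Fin n) | (R.filter fun v => ω ∈ openConn o v).card ≤ 1} ⊆
        (openConn o v : Set (BondConfig (Fin n)))ᶜ := by
      intro ω hω hωv
      have hoF : o ∈ R.filter fun u => ω ∈ openConn o u :=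
        Finset.mem_filter.2 ⟨hoR, (SimpleGraph.Reachable.refl o : (openGraph ω).Reachable o o)⟩
      have hvF : v ∈ R.filter fun u => ω ∈ openConn o u := Finset.mem_filter.2 ⟨hvR, hωv⟩
      have h2 : 1 < (R.filter fun u => ω ∈ openConn o u).card := Finset.one_lt_card.2 ⟨v, hvF, o, hoF, hvo⟩
      have h1 : (R.filter fun u => ω ∈ openConn o u).card ≤ 1 := hω
      omega
    exact (measureReal_mono hsub (measure_ne_top _ _)).trans (hcut v hvR)
  · -- `R ∪ {o}` exhausts the vertex set
    obtain ⟨a, b, c, hab, hac, hbc, hRabc⟩ := Finset.card_eq_three.1 hR3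
    have hcardI : (insert o R).card = 4 := by rw [Finset.card_insert_of_notMem hoR, hR3]
    have hle : (insert o R).card ≤ Fintype.card (Fin n) := Finset.card_le_univ _
    rw [Fintype.card_fin] at hle
    have hn4 : n = 4 := by omega
    have huniv_set : insert o R = Finset.univ :=
      Finset.eq_univ_of_card _ (by rw [hcardI, Fintype.card_fin, hn4])
    have huniv : ∀ u : Fin n, u = o ∨ u = a ∨ u = b ∨ u = c := by
      intro u
      have hu : u ∈ insert o R := by rw [huniv_set]; exact Finset.mem_univ u
      rw [Finset.mem_insert, hRabc] at hu
      simpa [Finset.mem_insert, Finset.mem_singleton] using hu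
    have hao : a ≠ o := fun h => hoR (by rw [hRabc, ← h]; simp)
    have hbo : b ≠ o := fun h => hoR (by rw [hRabc, ← h]; simp)
    have hco : c ≠ o := fun h => hoR (by rw [hRabc, ← h]; simp)
    have ha : a ∈ R := by rw [hRabc]; simp
    have hb : b ∈ R := by rw [hRabc]; simp
    have hc : c ∈ R := by rw [hRabc]; simp
    have hhalf' : 1 / 2 ≤ (prodBernoulli w).real (openConn o a) ∨ 1 / 2 ≤ (prodBernoulli w).real (openConn o b) ∨
        1 / 2 ≤ (prodBernoulli w).real (openConn o c) := by
      obtain ⟨v, hvR, hv⟩ := hhalf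
      rw [hRabc] at hvR
      simp only [Finset.mem_insert, Finset.mem_singleton] at hvR
      rcases hvR with rfl | rfl | rfl
      · exact Or.inl hv
      · exact Or.inr (Or.inl hv)
      · exact Or.inr (Or.inr hv)
    exact le_one_reached_le_K4_of_exists_half w R o a b c t hRabc hao hbo hco hab hac hbc huniv hhalf'
      (hcut a ha) (hcut b hb) (hcut c hc)

end ThreePort

end Summit.CriticalPhenomena.PercolationContinuityZ3.Theorems

end
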